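import Literature.AlgebraicGeometry.Modules.SerreTwistMod
import Literature.AlgebraicGeometry.Morphisms.CechH1ProjectiveFinite
import HarnessLib

/-!
# Positive Serre twists `N(e)`: chart pieces, `N(0) ≅ N`, functoriality, multiplication by `x_l`

Continuation of `Modules/SerreTwistMod` (`twistMod ι N e : Z.Modules`, sections = families
`(n_j ∈ Γ(U ∩ Z_j, N))_j` with `n_j = (x_{j'}/x_j)^e n_{j'}`). Everything here is a FORMULA on chart
pieces:

* `chartEquiv ι N hV : Γ(V, N(e)) ≃ₗ[Γ(V, 𝒪_Z)] Γ(V, N)` for `V ⊆ Z_{j₀}` — `(n_j) ↦ n_{j₀}`, inverse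
  `s ↦ ((x_{j₀}/x_j)^e s)_j`; natural in `V` (`chartEquiv_map`) and in `N` (`chartEquiv_twistModMap`);
* `toTwistZero ι N : N ⟶ N(0)`, `s ↦ (s|_{U ∩ Z_j})_j`, an ISOMORPHISM (`isIso_toTwistZero`: the sheaf
  axiom of `N` on the covers `U ∩ Z_j`), so `twistZeroIso ι N : N ≅ twistMod ι N 0`;
* `twistModMap ι φ e : N(e) ⟶ N'(e)` for `φ : N ⟶ N'` (componentwise), functorial;
* `mulXMod ι N e l : N(e) ⟶ N(e+1)`, `(n_j) ↦ ((x_l/x_j) n_j)_j` — multiplication by the global section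
  `x_l` of `𝒪(1)`; in the chart `Z_{j₀}` it is multiplication by the function `x_l/x_{j₀}`
  (`chartEquiv_mulXMod`), in particular bijective on sections over `V ⊆ Z_l`
  (`mulXMod_app_bijective_of_le`); it commutes with `twistModMap` (`twistModMap_mulXMod`).

References: Hartshorne II.5 (Prop. 5.12, and the maps `x_i : 𝒪(n) → 𝒪(n+1)` of the proof of Thm. 5.17);
Serre FAC nᵒ 54–55.
-/

noncomputable section

universe u

open CategoryTheory AlgebraicGeometry TopologicalSpace Opposite
open Literature.Algebra.Homology Literature.Algebra.Homology.LaurentCech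
open Literature.AlgebraicGeometry.Morphisms Literature.AlgebraicGeometry.Morphisms.ProjCech

attribute [local instance] MvPolynomial.gradedAlgebra
  Literature.AlgebraicGeometry.Motives.ProjBaseChange.algebraBase

namespace Literature.AlgebraicGeometry.Modules

namespace SerreTwist

variable {A : Type u} [CommRing A] {r : ℕ} {Z : Scheme.{u}} (ι : Z ⟶ PP A r) (N : Z.Modules)

attribute [local instance] ChartFamily.module

/-! ## Restriction helpers -/

omit ι in
/-- Restricting a section of `N` along two inequalities with the same ends agrees. [folklore] -/
theorem moduleMap_eq_of_le (M : Z.Modules) {U V : Z.Opens} (h : V ≤ U) (h' : V ≤ U) (s : Γ(M, U)) :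
    M.presheaf.map (homOfLE h).op s = M.presheaf.map (homOfLE h').op s := rfl

omit ι in
/-- `s|_V|_U' = s|_U'` also when the intermediate open only CONTAINS the target (restriction along
`V ⊆ U`, `U' ⊆ V`). [folklore] -/
theorem moduleMap_map_of_le (M : Z.Modules) {U V U' : Z.Opens} (h : V ≤ U) (h' : U' ≤ V) (h'' : U' ≤ U)
    (s : Γ(M, U)) :
    M.presheaf.map (homOfLE h').op (M.presheaf.map (homOfLE h).op s) = M.presheaf.map (homOfLE h'').op s :=
  moduleMap_map_apply M h h' s

omit ι in
/-- Restriction to an EQUAL open and back is the identity. [folklore] -/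
theorem moduleMap_map_of_eq (M : Z.Modules) {U V : Z.Opens} (h : V ≤ U) (h' : U ≤ V) (s : Γ(M, U)) :
    M.presheaf.map (homOfLE h').op (M.presheaf.map (homOfLE h).op s) = s := by
  rw [moduleMap_map_apply]
  have : (homOfLE (h'.trans h)).op = 𝟙 (op U) := Subsingleton.elim _ _
  rw [this, M.presheaf.map_id]; rfl

/-! ## The chart piece as a linear equivalence -/

variable {N} in
/-- The family `((x_{j₀}/x_j)^e · s|_{V ∩ Z_j})_j` of a section `s ∈ Γ(V, N)`, `V ⊆ Z_{j₀}`: its expression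
in all charts. [folklore] -/
def spread (e : ℕ) (j₀ : Fin (r + 1)) {V : Z.Opens} (s : Γ(N, V)) : ChartFamily ι N V :=
  fun j => Z.presheaf.map (homOfLE (inf_le_right : V ⊓ Zop ι {j} ≤ Zop ι {j})).op (chartFun ι j₀ j) ^ e •
    N.presheaf.map (homOfLE (inf_le_left : V ⊓ Zop ι {j} ≤ V)).op s

variable {N} in
/-- `spread` satisfies the transition rule (cocycle `x_{j₀}/x_j = (x_{j₀}/x_{j'})(x_{j'}/x_j)`). [folklore] -/
theorem isTwistFamily_spread (e : ℕ) (j₀ : Fin (r + 1)) {V : Z.Opens} (s : Γ(N, V)) :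
    IsTwistFamily ι N e V (spread ι e j₀ s) := by
  intro j j' W hW hj hj'
  simp only [spread, Scheme.Modules.map_smul, map_pow, IsTwistSection.map_map_apply, moduleMap_map_apply,
    smul_smul, ← mul_pow]
  rw [chartFun_cocycle ι j₀ j j' hj hj', mul_comm]

variable {N} in
/-- The `j₀`-piece of `spread … s` is `s` (`x_{j₀}/x_{j₀} = 1`), after restricting back to `V`. [folklore] -/
theorem spread_self (e : ℕ) {j₀ : Fin (r + 1)} {V : Z.Opens} (hV : V ≤ Zop ι {j₀}) (s : Γ(N, V)) :
    N.presheaf.map (homOfLE (le_inf le_rfl hV : V ≤ V ⊓ Zop ι {j₀})).op (spread ι e j₀ s j₀) = s := by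
  rw [spread, chartFun_self, map_one, one_pow, one_smul, moduleMap_map_of_eq]

/-- **The chart piece `(n_j) ↦ n_{j₀}` is a linear bijection `Γ(V, N(e)) ≃ Γ(V, N)` for `V ⊆ Z_{j₀}`**,
with inverse `s ↦ ((x_{j₀}/x_j)^e s)_j` (the trivialisation of `𝒪(e)` on the chart `Z_{j₀}`). [folklore] -/
def chartEquiv (e : ℕ) {j₀ : Fin (r + 1)} {V : Z.Opens} (hV : V ≤ Zop ι {j₀}) :
    Γ(twistMod ι N e, V) ≃ₗ[Γ(Z, V)] Γ(N, V) where
  toFun n := N.presheaf.map (homOfLE (le_inf le_rfl hV : V ≤ V ⊓ Zop ι {j₀})).op (comp ι N n j₀)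
  invFun s := mkFamily ι N (spread ι e j₀ s) (isTwistFamily_spread ι e j₀ s)
  map_add' n n' := by
    change N.presheaf.map _ (comp ι N (n + n') j₀) = N.presheaf.map _ (comp ι N n j₀) + N.presheaf.map _ (comp ι N n' j₀)
    rw [comp_add, map_add]
  map_smul' a n := by
    change N.presheaf.map _ (comp ι N (a • n) j₀) = a • N.presheaf.map _ (comp ι N n j₀)
    rw [comp_smul, Scheme.Modules.map_smul, IsTwistSection.map_map_apply]
    congr 1
    exact map_id_apply (SheafOfModules.unit _) a
  left_inv n := by
    apply twistMod_ext
    intro j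
    rw [comp_mkFamily]
    have key := isTwistFamily_comp ι N n j j₀ (V := V ⊓ Zop ι {j}) inf_le_left inf_le_right
      (inf_le_left.trans hV)
    rw [map_id_apply N (comp ι N n j)] at key
    rw [key, spread, moduleMap_map_apply]
  right_inv s := by
    change N.presheaf.map _ (comp ι N (mkFamily ι N _ _) j₀) = s
    rw [comp_mkFamily, spread_self ι e hV]

/-- `chartEquiv` is the restricted `j₀`-piece. [folklore] -/
theorem chartEquiv_apply (e : ℕ) {j₀ : Fin (r + 1)} {V : Z.Opens} (hV : V ≤ Zop ι {j₀}) (n : Γ(twistMod ι N e, V)) :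
    chartEquiv ι N e hV n = N.presheaf.map (homOfLE (le_inf le_rfl hV : V ≤ V ⊓ Zop ι {j₀})).op (comp ι N n j₀) :=
  rfl

/-- The inverse of `chartEquiv` spreads a section over all charts. [folklore] -/
theorem comp_chartEquiv_symm (e : ℕ) {j₀ : Fin (r + 1)} {V : Z.Opens} (hV : V ≤ Zop ι {j₀}) (s : Γ(N, V))
    (j : Fin (r + 1)) : comp ι N ((chartEquiv ι N e hV).symm s) j = spread ι e j₀ s j := rfl

/-- All chart pieces of a section over `V ⊆ Z_{j₀}` in terms of its `j₀`-coordinate: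
`n_j = (x_{j₀}/x_j)^e · (chartEquiv n)|_{V ∩ Z_j}`. [folklore] -/
theorem comp_eq_spread_chartEquiv (e : ℕ) {j₀ : Fin (r + 1)} {V : Z.Opens} (hV : V ≤ Zop ι {j₀})
    (n : Γ(twistMod ι N e, V)) (j : Fin (r + 1)) : comp ι N n j = spread ι e j₀ (chartEquiv ι N e hV n) j := by
  conv_lhs => rw [← (chartEquiv ι N e hV).symm_apply_apply n]
  rfl

/-- **Naturality of the chart coordinate under restriction.** [folklore] -/
theorem chartEquiv_map (e : ℕ) {j₀ : Fin (r + 1)} {V V' : Z.Opens} (hV : V ≤ Zop ι {j₀}) (h : V' ≤ V)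
    (n : Γ(twistMod ι N e, V)) :
    chartEquiv ι N e (h.trans hV) ((twistMod ι N e).presheaf.map (homOfLE h).op n) =
      N.presheaf.map (homOfLE h).op (chartEquiv ι N e hV n) := by
  rw [chartEquiv_apply, chartEquiv_apply, comp_map, moduleMap_map_apply, moduleMap_map_apply]

/-! ## Morphisms into and out of `N(e)` from chart formulas -/

omit ι in
/-- Morphisms of sheaves of modules commute with restriction (elementwise). [folklore] -/
theorem hom_map_app {M M' : Z.Modules} (φ : M ⟶ M') {V W : Z.Opens} (h : W ≤ V) (m : Γ(M, V)) :
    M'.presheaf.map (homOfLE h).op (φ.app V m) = φ.app W (M.presheaf.map (homOfLE h).op m) :=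
  (ConcreteCategory.congr_hom (φ.mapPresheaf.naturality (homOfLE h).op) m).symm

/-- **Constructor for morphisms `M ⟶ N(e)`** from a family of additive maps on sections commuting with
restriction and the action (the `PresheafOfModules.homMk` pattern, packaged). [folklore] -/
def homMkTwist {M : Z.Modules} (e : ℕ) (F : ∀ U : Z.Opens, Γ(M, U) →+ Γ(twistMod ι N e, U))
    (hres : ∀ (U V : Z.Opens) (h : V ≤ U) (m : Γ(M, U)) (j : Fin (r + 1)),
      comp ι N (F V (M.presheaf.map (homOfLE h).op m)) j =
        N.presheaf.map (homOfLE (inf_le_inf_right (Zop ι {j}) h)).op (comp ι N (F U m) j))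
    (hsmul : ∀ (U : Z.Opens) (a : Γ(Z, U)) (m : Γ(M, U)) (j : Fin (r + 1)),
      comp ι N (F U (a • m)) j = Z.presheaf.map (homOfLE (inf_le_left : U ⊓ Zop ι {j} ≤ U)).op a • comp ι N (F U m) j) :
    M ⟶ twistMod ι N e where
  val := PresheafOfModules.homMk
    { app := fun U => AddCommGrpCat.ofHom (F U.unop)
      naturality := fun U V g => by
        ext m
        apply twistMod_ext
        intro j
        change comp ι N (F V.unop (M.presheaf.map g m)) j =
          N.presheaf.map _ (comp ι N (F U.unop m) j)
        have eg : g = (homOfLE g.unop.le).op := Subsingleton.elim _ _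
        rw [eg]
        exact hres U.unop V.unop g.unop.le m j }
    (fun U a m => twistMod_ext ι N fun j => (hsmul U.unop a m j).trans (comp_smul ι N a (F U.unop m) j).symm)

/-- Sections of `homMkTwist`: definitionally the given maps. [folklore] -/
@[simp]
theorem homMkTwist_app {M : Z.Modules} (e : ℕ) (F : ∀ U : Z.Opens, Γ(M, U) →+ Γ(twistMod ι N e, U))
    (hres : ∀ (U V : Z.Opens) (h : V ≤ U) (m : Γ(M, U)) (j : Fin (r + 1)),
      comp ι N (F V (M.presheaf.map (homOfLE h).op m)) j =
        N.presheaf.map (homOfLE (inf_le_inf_right (Zop ι {j}) h)).op (comp ι N (F U m) j))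
    (hsmul : ∀ (U : Z.Opens) (a : Γ(Z, U)) (m : Γ(M, U)) (j : Fin (r + 1)),
      comp ι N (F U (a • m)) j = Z.presheaf.map (homOfLE (inf_le_left : U ⊓ Zop ι {j} ≤ U)).op a • comp ι N (F U m) j)
    (U : Z.Opens) (m : Γ(M, U)) : (homMkTwist ι N e F hres hsmul).app U m = F U m := rfl

/-! ## `N ≅ N(0)` -/

/-- The family of restrictions `(s|_{U ∩ Z_j})_j` is a twist family of every degree `0`... in degree `0`.
[folklore] -/
theorem isTwistFamily_restrict_zero (U : Z.Opens) (s : Γ(N, U)) :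
    IsTwistFamily ι N 0 U fun j => N.presheaf.map (homOfLE (inf_le_left : U ⊓ Zop ι {j} ≤ U)).op s := by
  intro j j' V hV hj hj'
  rw [pow_zero, one_smul, moduleMap_map_apply, moduleMap_map_apply]

/-- **`N ⟶ N(0)`**, `s ↦ (s|_{U ∩ Z_j})_j`. [folklore] -/
def toTwistZero : N ⟶ twistMod ι N 0 :=
  homMkTwist ι N 0
    (fun U =>
      { toFun := fun s => mkFamily ι N _ (isTwistFamily_restrict_zero ι N U s)
        map_zero' := twistMod_ext ι N fun j => by rw [comp_mkFamily, map_zero, comp_zero]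
        map_add' := fun s s' => twistMod_ext ι N fun j => by rw [comp_mkFamily, comp_add, comp_mkFamily, comp_mkFamily, map_add] })
    (fun U V h s j => by
      change N.presheaf.map _ (N.presheaf.map _ s) = N.presheaf.map _ (N.presheaf.map _ s)
      rw [moduleMap_map_apply, moduleMap_map_apply])
    (fun U a s j => by
      change N.presheaf.map _ (a • s) = _ • N.presheaf.map _ s
      rw [Scheme.Modules.map_smul])

/-- Chart pieces of `toTwistZero`: the restrictions. [folklore] -/
@[simp]
theorem comp_toTwistZero_app (U : Z.Opens) (s : Γ(N, U)) (j : Fin (r + 1)) :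
    comp ι N ((toTwistZero ι N).app U s) j = N.presheaf.map (homOfLE (inf_le_left : U ⊓ Zop ι {j} ≤ U)).op s := rfl

/-- Every open is covered by its chart pieces `U ∩ Z_j`. [folklore] -/
theorem le_iSup_inf_Zop (U : Z.Opens) : U ≤ ⨆ j : Fin (r + 1), U ⊓ Zop ι {j} := by
  rw [← inf_iSup_eq]
  have h : ⨆ i, Zop ι ({i} : Finset (Fin (r + 1))) = ⊤ := iSup_cover_eq_top ι
  rw [h, inf_top_eq]

/-- `toTwistZero` is injective on sections (a section vanishing on the cover `U ∩ Z_j` vanishes). [folklore] -/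
theorem toTwistZero_app_injective (U : Z.Opens) : Function.Injective ((toTwistZero ι N).app U) := by
  intro s s' h
  apply TopCat.Sheaf.eq_of_locally_eq' (⟨N.presheaf, N.isSheaf⟩ : TopCat.Sheaf Ab Z) (fun j => U ⊓ Zop ι {j}) U
    (fun j => homOfLE inf_le_left) (le_iSup_inf_Zop ι U)
  intro j
  exact congrArg (fun n => comp ι N n j) h

/-- `toTwistZero` is surjective on sections (glue the chart pieces, which agree on overlaps in degree `0`).
[folklore] -/
theorem toTwistZero_app_surjective (U : Z.Opens) : Function.Surjective ((toTwistZero ι N).app U) := by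
  intro n
  have hcompat : TopCat.Presheaf.IsCompatible N.presheaf (fun j : Fin (r + 1) => U ⊓ Zop ι {j})
      fun j => comp ι N n j := by
    intro j j'
    have key := isTwistFamily_comp ι N n j j' (V := U ⊓ Zop ι {j} ⊓ (U ⊓ Zop ι {j'}))
      (inf_le_left.trans inf_le_left) (inf_le_left.trans inf_le_right) (inf_le_right.trans inf_le_right)
    rw [pow_zero, one_smul] at key
    exact key
  obtain ⟨s, hs⟩ := (TopCat.Sheaf.existsUnique_gluing' (⟨N.presheaf, N.isSheaf⟩ : TopCat.Sheaf Ab Z)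
    (fun j => U ⊓ Zop ι {j}) U (fun j => homOfLE inf_le_left) (le_iSup_inf_Zop ι U) (fun j => comp ι N n j)
    hcompat).exists
  exact ⟨s, twistMod_ext ι N fun j => hs j⟩

/-- **`N ⟶ N(0)` is an isomorphism.** [folklore] -/
instance isIso_toTwistZero : IsIso (toTwistZero ι N) :=
  Scheme.Modules.Hom.isIso_iff_isIso_app.mpr fun U =>
    (ConcreteCategory.isIso_iff_bijective _).mpr ⟨toTwistZero_app_injective ι N U, toTwistZero_app_surjective ι N U⟩

/-- **`N ≅ N(0)`.** [folklore] -/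
def twistZeroIso : N ≅ twistMod ι N 0 := asIso (toTwistZero ι N)

/-! ## Functoriality in `N` -/

variable {N} {N' : Z.Modules}

/-- **`φ(e) : N(e) ⟶ N'(e)`** for `φ : N ⟶ N'`: componentwise `φ`. [folklore] -/
def twistModMap (φ : N ⟶ N') (e : ℕ) : twistMod ι N e ⟶ twistMod ι N' e :=
  homMkTwist ι N' e
    (fun U =>
      { toFun := fun n => mkFamily ι N' (fun j => φ.app _ (comp ι N n j)) (by
          intro j j' V hV hj hj'
          change N'.presheaf.map _ (φ.app _ (comp ι N n j)) = _ • N'.presheaf.map _ (φ.app _ (comp ι N n j'))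
          rw [hom_map_app, hom_map_app, isTwistFamily_comp ι N n j j' hV hj hj', Scheme.Modules.Hom.app_smul])
        map_zero' := twistMod_ext ι N' fun j => by rw [comp_mkFamily, comp_zero, comp_zero, map_zero]
        map_add' := fun n n' => twistMod_ext ι N' fun j => by
          rw [comp_mkFamily, comp_add, comp_add, comp_mkFamily, comp_mkFamily, map_add] })
    (fun U V h n j => by
      change φ.app _ (comp ι N ((twistMod ι N e).presheaf.map (homOfLE h).op n) j) = N'.presheaf.map _ (φ.app _ (comp ι N n j))
      rw [comp_map, hom_map_app])
    (fun U a n j => by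
      change φ.app _ (comp ι N (a • n) j) = _ • φ.app _ (comp ι N n j)
      rw [comp_smul, Scheme.Modules.Hom.app_smul])

/-- Chart pieces of `φ(e) n`: `φ (n_j)`. [folklore] -/
@[simp]
theorem comp_twistModMap_app (φ : N ⟶ N') (e : ℕ) (U : Z.Opens) (n : Γ(twistMod ι N e, U)) (j : Fin (r + 1)) :
    comp ι N' ((twistModMap ι φ e).app U n) j = φ.app _ (comp ι N n j) := rfl

/-- `(𝟙 N)(e) = 𝟙`. [folklore] -/
@[simp]
theorem twistModMap_id (e : ℕ) : twistModMap ι (𝟙 N) e = 𝟙 (twistMod ι N e) := by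
  ext U n j
  rfl

/-- `(φ ≫ ψ)(e) = φ(e) ≫ ψ(e)`. [folklore] -/
theorem twistModMap_comp {N'' : Z.Modules} (φ : N ⟶ N') (ψ : N' ⟶ N'') (e : ℕ) :
    twistModMap ι (φ ≫ ψ) e = twistModMap ι φ e ≫ twistModMap ι ψ e := by
  ext U n j
  rfl

/-- `0(e) = 0`. [folklore] -/
@[simp]
theorem twistModMap_zero (e : ℕ) : twistModMap ι (0 : N ⟶ N') e = 0 := by
  ext U n j
  rfl

/-- `φ(e)` is additive in `φ`. [folklore] -/
theorem twistModMap_add (φ ψ : N ⟶ N') (e : ℕ) : twistModMap ι (φ + ψ) e = twistModMap ι φ e + twistModMap ι ψ e := by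
  ext U n j
  rfl

variable (N)

/-- **The twisting functor `N ↦ N(e)`** on `𝒪_Z`-modules. [folklore] -/
def twistModFunctor (e : ℕ) : Z.Modules ⥤ Z.Modules where
  obj N := twistMod ι N e
  map φ := twistModMap ι φ e
  map_id _ := twistModMap_id ι e
  map_comp φ ψ := twistModMap_comp ι φ ψ e

/-- The twisting functor is additive. [folklore] -/
instance twistModFunctor_additive (e : ℕ) : (twistModFunctor ι (Z := Z) e).Additive where
  map_add := twistModMap_add ι _ _ e

/-- **Naturality of the chart coordinate in `N`**: `chartEquiv (φ(e) n) = φ (chartEquiv n)`. [folklore] -/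
theorem chartEquiv_twistModMap {N' : Z.Modules} (φ : N ⟶ N') (e : ℕ) {j₀ : Fin (r + 1)} {V : Z.Opens}
    (hV : V ≤ Zop ι {j₀}) (n : Γ(twistMod ι N e, V)) :
    chartEquiv ι N' e hV ((twistModMap ι φ e).app V n) = φ.app V (chartEquiv ι N e hV n) := by
  rw [chartEquiv_apply, chartEquiv_apply, comp_twistModMap_app, hom_map_app]

/-! ## Multiplication by a variable `x_l : N(e) → N(e+1)` -/

/-- The family `((x_l/x_j) · n_j)_j` of a twist family of degree `e` is a twist family of degree `e + 1`
(cocycle `x_l/x_j = (x_{j'}/x_j)(x_l/x_{j'})`). [folklore] -/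
theorem isTwistFamily_mulX (e : ℕ) (l : Fin (r + 1)) {U : Z.Opens} (n : Γ(twistMod ι N e, U)) :
    IsTwistFamily ι N (e + 1) U fun j =>
      Z.presheaf.map (homOfLE (inf_le_right : U ⊓ Zop ι {j} ≤ Zop ι {j})).op (chartFun ι l j) • comp ι N n j := by
  intro j j' V hV hj hj'
  rw [Scheme.Modules.map_smul, Scheme.Modules.map_smul, IsTwistSection.map_map_apply,
    IsTwistSection.map_map_apply, isTwistFamily_comp ι N n j j' hV hj hj', smul_smul, smul_smul, pow_succ,
    map_congr (V := V) ((le_inf hV hj).trans inf_le_right) hj, chartFun_cocycle ι l j j' hj hj']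
  congr 1
  ring

/-- **Multiplication by the variable `x_l`**, `N(e) ⟶ N(e+1)`, `(n_j) ↦ ((x_l/x_j) n_j)_j` (the global section
`x_l` of `𝒪(1)`; Hartshorne II, proof of Thm. 5.17). [folklore] -/
def mulXMod (e : ℕ) (l : Fin (r + 1)) : twistMod ι N e ⟶ twistMod ι N (e + 1) :=
  homMkTwist ι N (e + 1)
    (fun U =>
      { toFun := fun n => mkFamily ι N _ (isTwistFamily_mulX ι N e l n)
        map_zero' := twistMod_ext ι N fun j => by rw [comp_mkFamily, comp_zero, comp_zero, smul_zero]
        map_add' := fun n n' => twistMod_ext ι N fun j => by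
          rw [comp_mkFamily, comp_add, comp_add, comp_mkFamily, comp_mkFamily, smul_add] })
    (fun U V h n j => by
      change _ • comp ι N ((twistMod ι N e).presheaf.map (homOfLE h).op n) j = N.presheaf.map _ (_ • comp ι N n j)
      rw [comp_map, Scheme.Modules.map_smul, IsTwistSection.map_map_apply])
    (fun U a n j => by
      change _ • comp ι N (a • n) j = _ • (_ • comp ι N n j)
      rw [comp_smul, smul_comm])

/-- Chart pieces of `x_l · n`: `(x_l/x_j) n_j`. [folklore] -/
@[simp]
theorem comp_mulXMod_app (e : ℕ) (l : Fin (r + 1)) (U : Z.Opens) (n : Γ(twistMod ι N e, U)) (j : Fin (r + 1)) :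
    comp ι N ((mulXMod ι N e l).app U n) j =
      Z.presheaf.map (homOfLE (inf_le_right : U ⊓ Zop ι {j} ≤ Zop ι {j})).op (chartFun ι l j) • comp ι N n j := rfl

/-- **In the chart `Z_{j₀}`, multiplication by `x_l` is multiplication by the function `x_l/x_{j₀}`.** [folklore] -/
theorem chartEquiv_mulXMod (e : ℕ) (l : Fin (r + 1)) {j₀ : Fin (r + 1)} {V : Z.Opens} (hV : V ≤ Zop ι {j₀})
    (n : Γ(twistMod ι N e, V)) :
    chartEquiv ι N (e + 1) hV ((mulXMod ι N e l).app V n) =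
      Z.presheaf.map (homOfLE hV).op (chartFun ι l j₀) • chartEquiv ι N e hV n := by
  rw [chartEquiv_apply, chartEquiv_apply, comp_mulXMod_app, Scheme.Modules.map_smul, IsTwistSection.map_map_apply]

/-- Over `V ⊆ Z_l`, multiplication by `x_l` is the identity in the chart coordinate of `Z_l`. [folklore] -/
theorem chartEquiv_mulXMod_self (e : ℕ) (l : Fin (r + 1)) {V : Z.Opens} (hV : V ≤ Zop ι {l})
    (n : Γ(twistMod ι N e, V)) :
    chartEquiv ι N (e + 1) hV ((mulXMod ι N e l).app V n) = chartEquiv ι N e hV n := by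
  rw [chartEquiv_mulXMod, chartFun_self, map_one, one_smul]

/-- **Multiplication by `x_l` is bijective on sections over `V ⊆ Z_l`.** [folklore] -/
theorem mulXMod_app_bijective_of_le (e : ℕ) (l : Fin (r + 1)) {V : Z.Opens} (hV : V ≤ Zop ι {l}) :
    Function.Bijective ((mulXMod ι N e l).app V) := by
  have h : (mulXMod ι N e l).app V =
      (chartEquiv ι N (e + 1) hV).symm ∘ (chartEquiv ι N e hV) := by
    funext n
    apply (chartEquiv ι N (e + 1) hV).injective
    rw [Function.comp_apply, LinearEquiv.apply_symm_apply, chartEquiv_mulXMod_self]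
  rw [show ((mulXMod ι N e l).app V : Γ(twistMod ι N e, V) → Γ(twistMod ι N (e + 1), V)) =
    (chartEquiv ι N (e + 1) hV).symm ∘ (chartEquiv ι N e hV) from h]
  exact (chartEquiv ι N (e + 1) hV).symm.bijective.comp (chartEquiv ι N e hV).bijective

/-- Multiplication by `x_l` commutes with `φ(e)`. [folklore] -/
theorem twistModMap_mulXMod {N' : Z.Modules} (φ : N ⟶ N') (e : ℕ) (l : Fin (r + 1)) :
    twistModMap ι φ e ≫ mulXMod ι N' e l = mulXMod ι N e l ≫ twistModMap ι φ (e + 1) := by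
  ext U n j
  change comp ι N' ((mulXMod ι N' e l).app U ((twistModMap ι φ e).app U n)) j =
    comp ι N' ((twistModMap ι φ (e + 1)).app U ((mulXMod ι N e l).app U n)) j
  rw [comp_mulXMod_app, comp_twistModMap_app, comp_twistModMap_app, comp_mulXMod_app, Scheme.Modules.Hom.app_smul]

end SerreTwist

end Literature.AlgebraicGeometry.Modules

end
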